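import Summits.MatrixMultiplication.MatrixMultiplication.Theses.SnSubsetDichotomy

/-!
# `SnSubsetDichotomy.NoThresholdIffNotThreshold` — the negative side is the negation of the target

Item `stmt-MatrixMultiplication-10885` (support, route `SnSubsetDichotomy`):
`NoThresholdSubsetTriple ↔ ¬ ThresholdSubsetTriples`.

Pure logic.  `ThresholdSubsetTriples` says: for every `c > 0` and every `n₀` there are `n ≥ n₀` and a
TPP triple `S, T, U ⊆ S_n` with `(n!)^{3/2}·e^{-c√n} < |S||T||U|`; `NoThresholdSubsetTriple` says:
there are `c > 0` and `n₀` such that for all `n ≥ n₀` every TPP triple has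
`|S||T||U| ≤ (n!)^{3/2}·e^{-c√n}`.  Pushing the negation through the quantifiers
(`¬∀ = ∃¬`, `¬∃ = ∀¬`, `¬(p ∧ q) = (p → ¬q)`, `¬(a < b) = (b ≤ a)` in `ℝ`) turns `¬ ThresholdSubsetTriples`
into `NoThresholdSubsetTriple` on the nose.
-/

-- `Summit.<Summit>.<Problem>` is the tree's mandated summit-side namespace; for this
-- single-conjunct summit the two coincide, so the file silences `dupNamespace`.
set_option linter.dupNamespace false

namespace Summit.MatrixMultiplication.MatrixMultiplication.Theorems

open Summit.MatrixMultiplication.MatrixMultiplication.Theses.SnSubsetDichotomy in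
/-- **Bookkeeping** (item `stmt-MatrixMultiplication-10885`): the negative milestone
`NoThresholdSubsetTriple` (uniform bound `|S||T||U| ≤ (n!)^{3/2}e^{-c√n}` for all TPP subset triples
of `S_n`, some `c > 0`, all large `n`) is *exactly* the negation of the route's target
`ThresholdSubsetTriples` (threshold TPP subset triples exist for every `c > 0` beyond every `n₀`).
Proof: unfold and push the negation through the quantifiers. -/
theorem noThresholdIffNotThreshold_proof :
    Summit.MatrixMultiplication.MatrixMultiplication.Theses.SnSubsetDichotomy.NoThresholdIffNotThreshold := by
  unfold NoThresholdIffNotThreshold NoThresholdSubsetTriple ThresholdSubsetTriples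
  push Not
  rfl

end Summit.MatrixMultiplication.MatrixMultiplication.Theorems
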